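import Literature.Barriers.CriticalPhenomena.PlaquetteWalkHoleRootThinTop
import HarnessLib

/-!
# Barrier catalogue (SAWScalingLimit): THIN-TOP LAW L AT THE SIDE WALLS — a hole one row below the top wall AND two
columns from the west wall, or with its root plaquette two columns from the east wall

Assembly leaf (no new mechanism, no new definition) of `PlaquetteWalkHoleRootThinTop` (thin-top tools, `thinTopBox_hyps`) and,
through it, `PlaquetteWalkHoleRootWallPocket` (a western pocket on the wall empties the under route),
`PlaquetteWalkHoleRootWestCorridor` / `PlaquetteWalkHoleRootCorridor` + `PlaquetteWalkHoleRootLawLBoxes` (the corner corridors of a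
box), `PlaquetteWalkHoleRootThinSide` (the under blocks; the thin TOP side: the over route is EMPTY). The row mirror of
`PlaquetteWalkHoleRootThinBoxWalls`. Setting: the `m × n` box, hole `h` with `h.2 + 2 = n` (ONE row below the top wall), root
plaquette `w = (h.1 + 1, h.2)` rooted at `W`, far cell `(h.1 − 1, h.2)`; printed weights, `θ ∈ [π/3, 2π/3]`; ONE further cell
removed.

* §1 tools: `vertexFunctional_printed_two_pi_div_three_eq_zero_of_thinN_of_under_w1_killed`,
  `im_vertexFunctional_printed_neg_of_thinN_of_w2free` (`Im VF < 0` on `[π/3, 2π/3)` from a `w₂`-free under witness).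
* §2 WEST wall two columns away (`h.1 = 2`): the south-western pocket `(0, h.2 − 1)` ⇒ BOTH routes empty ⇒ `VF ≡ 0`
  (`thinTopW_pocketSW_vertexFunctional_eq_zero`); the corner `K_S2 = (0, h.2 − 2)` (`h.2 ≥ 2`) ⇒ the under route `w₂`-killed ⇒
  `VF(π/3) = 0` EXACTLY and `Im VF < 0` on `(π/3, 2π/3]` (`thinTopW_killSW_…`).
* §3 EAST wall, root plaquette two columns from it (`h.1 + 3 = m`): `K_S1 = (h.1 + 2, h.2 − 2)` ⇒ `VF(2π/3) = 0` exactly and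
  `Im VF < 0` on `[π/3, 2π/3)` (`thinTopE_killSE_…`).
* §4 every thin top box (`2 ≤ h.1 ≤ m − 3`, `h.2 ≥ 2`): the north-western pocket `(h.1 − 2, h.2 + 1)` is harmless — `Im VF < 0`,
  `VF ≠ 0` on the whole range (`thinTop_pocketNW_vertexFunctional_ne_zero`; both under blocks avoid it).

Not in print; venture lane «pcv-sawmu», seat b-step0 gen 27.

References: A. Glazman, I. Manolescu, arXiv:1708.00395v3, §1 (Fig. 2, the remark after eq. (1)), §2.1, §4.2, Lemma 2.1
[GlazmanManolescu2019]; A. Glazman, Electron. Commun. Probab. 20 (2015) no. 86, Lemma 3.1, proof pp. 6–7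
[Glazman2015WeightedSAW]; R. Courant, H. Robbins, *What is Mathematics?* (1941/1958), Ch. V Appendix §2 (the even–odd rule)
[CourantRobbins1958].
-/

noncomputable section

open Set Function Complex

namespace Literature.Barriers.CriticalPhenomena.PlaquetteWalk

open Literature.Probability.RandomPlanarGeometry.SAW.YangBaxter
open Real Complex

/-! ## §1 Two more thin-top tools -/

section ThinTopTools2

variable {Dl : List Face} {w : Face}

/-- **Thin top + under route `w₁`-killed ⇒ `VF(2π/3) = 0`.** [cite: GlazmanManolescu2019, §1 (remark after eq. (1)), Lemma 2.1]
[cite: Glazman2015WeightedSAW, Lemma 3.1 (proof, pp. 6–7)] -/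
theorem vertexFunctional_printed_two_pi_div_three_eq_zero_of_thinN_of_under_w1_killed
    (hf : farW w ∈ Dl) (hh : holeFaceW w ∉ dom Dl) (hKN : killNW w ∉ dom Dl) (hT : ((w.1 - 2, w.2 + 2) : Face) ∉ dom Dl)
    (hcolN : ∀ y : ℤ, w.2 + 3 ≤ y → (w.1 - 3, y) ∉ dom Dl ∨ (w.1 - 2, y) ∉ dom Dl)
    (hr : RootedFace (dom Dl) (w.side .W) (farW w))
    (hK : ∀ (ω : ΩG (dom Dl) (w.side .W) (farW w)) (h : ω.IsB2a), ω.2.firstSideG = .S →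
      ω.WE (fun _ => 2 * π / 3) ≠ excursionWinding (2 * π / 3) ω.2.firstSideG (ω.z1 hr h) ω.1 → ¬ω.2.W1FreeOff (farW w)) :
    vertexFunctional (printedWeights (2 * π / 3)) tFiveEighths (ybCoeff (2 * π / 3)) Dl (w.side .W) (farW w) = 0 := by
  have hθ : (2 * π / 3 : ℝ) ∈ Set.Icc (π / 3) (2 * π / 3) := ⟨by linarith [Real.pi_pos], le_rfl⟩
  rw [vertexFunctional_printed_farCellW_eq hθ Dl w hf hh hr, ΩG.sum_routeMassW_N_eq_zero_of_thinN hh hKN hcolN hT hr _,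
    ΩG.sum_routeMassW_two_pi_div_three_eq_zero_of_killed hr .S hK]
  simp

/-- **Thin top + ONE `w₂`-free wound under-walk at every angle ⇒ `Im VF(θ) < 0` for `θ ∈ [π/3, 2π/3)`.**
[cite: GlazmanManolescu2019, Lemma 2.1, §1 eq. (1) and Fig. 2] [cite: Glazman2015WeightedSAW, Lemma 3.1 (proof, pp. 6–7)] -/
theorem im_vertexFunctional_printed_neg_of_thinN_of_w2free {θ : ℝ} (hθ : θ ∈ Set.Ico (π / 3) (2 * π / 3))
    (hf : farW w ∈ Dl) (hh : holeFaceW w ∉ dom Dl) (hKN : killNW w ∉ dom Dl) (hT : ((w.1 - 2, w.2 + 2) : Face) ∉ dom Dl)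
    (hcolN : ∀ y : ℤ, w.2 + 3 ≤ y → (w.1 - 3, y) ∉ dom Dl ∨ (w.1 - 2, y) ∉ dom Dl)
    (hr : RootedFace (dom Dl) (w.side .W) (farW w))
    (hU2 : ∀ θ' : ℝ, ∃ (ω : ΩG (dom Dl) (w.side .W) (farW w)) (h : ω.IsB2a), ω.2.firstSideG = .S ∧
      ω.WE (fun _ => θ') ≠ excursionWinding θ' ω.2.firstSideG (ω.z1 hr h) ω.1 ∧ ω.2.W2FreeOff (farW w)) :
    (vertexFunctional (printedWeights θ) tFiveEighths (ybCoeff θ) Dl (w.side .W) (farW w)).im < 0 := by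
  have hθ' : θ ∈ Set.Icc (π / 3) (2 * π / 3) := ⟨hθ.1, hθ.2.le⟩
  rcases eq_or_lt_of_le hθ.1 with e1 | h1
  · rw [← e1]
    exact im_vertexFunctional_printed_farCellW_pi_div_three_neg_of_over_killed Dl w hf hh hr
      (ΩG.over_killed_both_of_thinN hh hKN hcolN hT hr _).1 (hU2 _)
  have hθo : θ ∈ Set.Ioo (π / 3) (2 * π / 3) := ⟨h1, hθ.2⟩
  rw [vertexFunctional_printed_farCellW_im_eq hθ' Dl w hf hh hr, ΩG.sum_routeMassW_N_eq_zero_of_thinN hh hKN hcolN hT hr θ,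
    zero_sub, mul_neg, neg_lt_zero]
  obtain ⟨ω, h, hSd, hW, -⟩ := hU2 θ
  exact mul_pos (weightV_pos_of_mem_Ioo ⟨by linarith [hθo.1, Real.pi_pos], by linarith [hθo.2, Real.pi_pos]⟩)
    (ΩG.sum_routeMassW_pos_of_wound hr .S hθo ⟨ω, h, hSd, hW⟩)

end ThinTopTools2

section ThinTopWalls

variable {m n : ℕ} {h : Face}

/-! ## §2 The west wall two columns from the hole -/

/-- ★★★★ **THIN TOP BOX, WEST WALL TWO COLUMNS AWAY, THE SOUTH-WESTERN POCKET `(0, h.2 − 1)` REMOVED ⇒ `VF ≡ 0`.** The pocket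
on the wall empties the under route (`ΩG.WE_eq_excursionWinding_of_under_wallPocketSW`), the thin top the over route.
[cite: GlazmanManolescu2019, Lemma 2.1 (statement, "in the form given in [Gl]"), §2.1] [cite: Glazman2015WeightedSAW, Lemma 3.1 (proof, pp. 6–7)]
[cite: CourantRobbins1958, Ch. V Appendix §2 (the even–odd rule)] -/
theorem thinTopW_pocketSW_vertexFunctional_eq_zero (hW : h.1 = 2) (hE : h.1 + 3 ≤ m) (hS : 1 ≤ h.2) (hN : h.2 + 2 = n)
    {θ : ℝ} (hθ : θ ∈ Set.Icc (π / 3) (2 * π / 3)) :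
    vertexFunctional (printedWeights θ) tFiveEighths (ybCoeff θ) (boxMinus m n [h, (0, h.2 - 1)])
      (Face.side (h.1 + 1, h.2) .W) (farW (h.1 + 1, h.2)) = 0 := by
  obtain ⟨hf, hh, hKN, hT, hcolN⟩ := thinTopBox_hyps (m := m) (n := n) (S := [h, (0, h.2 - 1)]) (by omega) (by omega)
    (by omega) hN (by simp) (by
      rw [List.mem_cons, List.mem_singleton, not_or]
      exact ⟨fun e => by have := (Prod.ext_iff.1 e).1; simp only at this; omega,
        fun e => by have := (Prod.ext_iff.1 e).2; simp only at this; omega⟩)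
  have hr := rootedFace_hroot_boxMinus_of_mem hf (by simp)
  refine vertexFunctional_printed_eq_zero_of_thinN_of_under_empty hθ hf hh hKN hT hcolN hr fun ω hb hSd => ?_
  refine ΩG.WE_eq_excursionWinding_of_under_wallPocketSW hh ?_ (fun x hx => ?_) ω hr hb hSd θ
  · have e : pocketSW ((h.1 + 1, h.2) : Face) = (0, h.2 - 1) := Prod.ext (by simp only [pocketSW]; omega) (by simp only [pocketSW])
    rw [e]; exact not_mem_dom_boxMinus_of_mem (by simp)
  · left; intro hm; have hb' := (mem_dom_boxMinus.1 hm).1; simp only at hb' hx; omega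

/-- ★★★★★ **THIN TOP BOX, WEST WALL TWO COLUMNS AWAY, THE CORNER `K_S2 = (0, h.2 − 2)` REMOVED ⇒ `VF(π/3) = 0` EXACTLY**
(`h.2 ≥ 2`): the under route is `w₂`-killed by the south-western corridor on the wall, the over route is empty.
[cite: GlazmanManolescu2019, §1 (the paragraph of Fig. 2), §2.1, Lemma 2.1] [cite: Glazman2015WeightedSAW, Lemma 3.1 (proof, pp. 6–7)]
[cite: CourantRobbins1958, Ch. V Appendix §2 (the even–odd rule)] -/
theorem thinTopW_killSW_vertexFunctional_pi_div_three_eq_zero (hW : h.1 = 2) (hE : h.1 + 3 ≤ m) (hS : 2 ≤ h.2)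
    (hN : h.2 + 2 = n) :
    vertexFunctional (printedWeights (π / 3)) tFiveEighths (ybCoeff (π / 3))
      (boxMinus m n [h, killSW (h.1 + 1, h.2)]) (Face.side (h.1 + 1, h.2) .W) (farW (h.1 + 1, h.2)) = 0 := by
  obtain ⟨hf, hh, hKN, hT, hcolN⟩ := thinTopBox_hyps (m := m) (n := n) (S := [h, killSW (h.1 + 1, h.2)]) (by omega)
    (by omega) (by omega) hN (by simp) (by
      rw [List.mem_cons, List.mem_singleton, not_or]
      exact ⟨fun e => by have := (Prod.ext_iff.1 e).1; simp only at this; omega,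
        fun e => by have := (Prod.ext_iff.1 e).2; simp only [killSW] at this; omega⟩)
  have hr := rootedFace_hroot_boxMinus_of_mem hf (by simp)
  refine vertexFunctional_printed_pi_div_three_eq_zero_of_thinN_of_under_w2_killed hf hh hKN hT hcolN hr ?_
  refine ΩG.under_killed_of_killSW_corridor hh (not_mem_dom_boxMinus_of_mem (by simp))
    (isCorridorSW_boxMinus (Or.inl hW) (by simp)) (fun y hy => ?_) hr _
  simp only at hy ⊢
  by_cases hD : ((h.1 + 1 - 3, y) : Face) ∈ dom (boxMinus m n [h, killSW (h.1 + 1, h.2)])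
  · right; right; simp only [Set.mem_setOf_eq]; exact ⟨hD, by omega, by omega⟩
  · exact Or.inl hD

/-- … and `Im VF(θ) < 0` for every `θ ∈ (π/3, 2π/3]` (the `w₁`-free under block survives).
[cite: GlazmanManolescu2019, §1 (remark after eq. (1)), §2.1, Lemma 2.1] [cite: Glazman2015WeightedSAW, Lemma 3.1 (proof, pp. 6–7)] -/
theorem thinTopW_killSW_im_neg_of_gt (hW : h.1 = 2) (hE : h.1 + 3 ≤ m) (hS : 2 ≤ h.2) (hN : h.2 + 2 = n) {θ : ℝ}
    (hθ : θ ∈ Set.Ioc (π / 3) (2 * π / 3)) :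
    (vertexFunctional (printedWeights θ) tFiveEighths (ybCoeff θ) (boxMinus m n [h, killSW (h.1 + 1, h.2)])
      (Face.side (h.1 + 1, h.2) .W) (farW (h.1 + 1, h.2))).im < 0 := by
  obtain ⟨hf, hh, hKN, hT, hcolN⟩ := thinTopBox_hyps (m := m) (n := n) (S := [h, killSW (h.1 + 1, h.2)]) (by omega)
    (by omega) (by omega) hN (by simp) (by
      rw [List.mem_cons, List.mem_singleton, not_or]
      exact ⟨fun e => by have := (Prod.ext_iff.1 e).1; simp only at this; omega,
        fun e => by have := (Prod.ext_iff.1 e).2; simp only [killSW] at this; omega⟩)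
  have hr := rootedFace_hroot_boxMinus_of_mem hf (by simp)
  have e : killSW ((h.1 + 1, h.2) : Face) = (h.1 - 2, h.2 - 2) :=
    Prod.ext (by simp only [killSW]; omega) (by simp only [killSW])
  have hB : ∀ c ∈ underBlockW (h.1 + 1, h.2), c ∈ boxMinus m n [h, killSW (h.1 + 1, h.2)] := by
    rw [e]
    exact block_hroot_subset_boxMinus_of_bounds (m := m) (n := n) (h := h) underBlockW42 1 5 0 3 1 0 (by decide)
      (by omega) (by omega) (by omega) (by omega) ⟨by omega, by omega⟩
  exact im_vertexFunctional_printed_neg_of_thinN_of_w1free hθ hf hh hKN hT hcolN hr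
    fun θ' => exists_under_w1free_of_underBlockW hB hr θ'

/-! ## §3 The root plaquette two columns from the east wall -/

/-- ★★★★★ **THIN TOP BOX, ROOT PLAQUETTE TWO COLUMNS FROM THE EAST WALL, THE CORNER `K_S1 = (h.1 + 2, h.2 − 2)` REMOVED ⇒
`VF(2π/3) = 0` EXACTLY** (`h.2 ≥ 2`): the under route is `w₁`-killed by the south-eastern corridor on the wall, the over route empty.
[cite: GlazmanManolescu2019, §1 (remark after eq. (1)), §2.1, Lemma 2.1] [cite: Glazman2015WeightedSAW, Lemma 3.1 (proof, pp. 6–7)]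
[cite: CourantRobbins1958, Ch. V Appendix §2 (the even–odd rule)] -/
theorem thinTopE_killSE_vertexFunctional_two_pi_div_three_eq_zero (hW : 2 ≤ h.1) (hE : h.1 + 3 = m) (hS : 2 ≤ h.2)
    (hN : h.2 + 2 = n) :
    vertexFunctional (printedWeights (2 * π / 3)) tFiveEighths (ybCoeff (2 * π / 3))
      (boxMinus m n [h, killSE (h.1 + 1, h.2)]) (Face.side (h.1 + 1, h.2) .W) (farW (h.1 + 1, h.2)) = 0 := by
  obtain ⟨hf, hh, hKN, hT, hcolN⟩ := thinTopBox_hyps (m := m) (n := n) (S := [h, killSE (h.1 + 1, h.2)]) hW (by omega)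
    (by omega) hN (by simp) (by
      rw [List.mem_cons, List.mem_singleton, not_or]
      exact ⟨fun e => by have := (Prod.ext_iff.1 e).1; simp only at this; omega,
        fun e => by have := (Prod.ext_iff.1 e).2; simp only [killSE] at this; omega⟩)
  have hr := rootedFace_hroot_boxMinus_of_mem hf (by simp)
  refine vertexFunctional_printed_two_pi_div_three_eq_zero_of_thinN_of_under_w1_killed hf hh hKN hT hcolN hr ?_
  refine ΩG.under_w1_killed_of_killSE_corridor hh (not_mem_dom_boxMinus_of_mem (by simp))
    (isCorridorS_boxMinus (Or.inl hE) (by simp)) (fun y hy => ?_) hr _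
  simp only at hy ⊢
  by_cases hD : ((h.1 + 1 + 1, y) : Face) ∈ dom (boxMinus m n [h, killSE (h.1 + 1, h.2)])
  · right; right; simp only [Set.mem_setOf_eq]; exact ⟨hD, by omega, by omega⟩
  · exact Or.inr (Or.inl hD)

/-- … and `Im VF(θ) < 0` for every `θ ∈ [π/3, 2π/3)` (the `w₂`-free under block survives).
[cite: GlazmanManolescu2019, §1 (Fig. 2), §2.1, Lemma 2.1] [cite: Glazman2015WeightedSAW, Lemma 3.1 (proof, pp. 6–7)] -/
theorem thinTopE_killSE_im_neg_of_lt (hW : 2 ≤ h.1) (hE : h.1 + 3 = m) (hS : 2 ≤ h.2) (hN : h.2 + 2 = n) {θ : ℝ}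
    (hθ : θ ∈ Set.Ico (π / 3) (2 * π / 3)) :
    (vertexFunctional (printedWeights θ) tFiveEighths (ybCoeff θ) (boxMinus m n [h, killSE (h.1 + 1, h.2)])
      (Face.side (h.1 + 1, h.2) .W) (farW (h.1 + 1, h.2))).im < 0 := by
  obtain ⟨hf, hh, hKN, hT, hcolN⟩ := thinTopBox_hyps (m := m) (n := n) (S := [h, killSE (h.1 + 1, h.2)]) hW (by omega)
    (by omega) hN (by simp) (by
      rw [List.mem_cons, List.mem_singleton, not_or]
      exact ⟨fun e => by have := (Prod.ext_iff.1 e).1; simp only at this; omega,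
        fun e => by have := (Prod.ext_iff.1 e).2; simp only [killSE] at this; omega⟩)
  have hr := rootedFace_hroot_boxMinus_of_mem hf (by simp)
  have e : killSE ((h.1 + 1, h.2) : Face) = (h.1 + 2, h.2 - 2) :=
    Prod.ext (by simp only [killSE]; omega) (by simp only [killSE])
  have hB : ∀ c ∈ underBlockE (h.1 + 1, h.2), c ∈ boxMinus m n [h, killSE (h.1 + 1, h.2)] := by
    rw [e]
    exact block_hroot_subset_boxMinus_of_bounds (m := m) (n := n) (h := h) underBlockE42 1 5 0 3 5 0 (by decide)
      (by omega) (by omega) (by omega) (by omega) ⟨by omega, by omega⟩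
  exact im_vertexFunctional_printed_neg_of_thinN_of_w2free hθ hf hh hKN hT hcolN hr
    fun θ' => exists_under_w2free_of_underBlockE hB hr θ'

/-! ## §4 The north-western pocket is harmless in every thin top box -/

/-- ★★★ **THIN TOP BOX, THE NORTH-WESTERN POCKET `(h.1 − 2, h.2 + 1)` REMOVED ⇒ `Im VF < 0`, `VF ≠ 0` ON THE WHOLE RANGE**
(`2 ≤ h.1 ≤ m − 3`, `h.2 ≥ 2`): both under blocks avoid it. [cite: GlazmanManolescu2019, Lemma 2.1 (statement, "in the form given in [Gl]"), §2.1]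
[cite: Glazman2015WeightedSAW, Lemma 3.1 (proof, pp. 6–7)] -/
theorem thinTop_pocketNW_vertexFunctional_ne_zero (hW : 2 ≤ h.1) (hE : h.1 + 3 ≤ m) (hS : 2 ≤ h.2) (hN : h.2 + 2 = n)
    {θ : ℝ} (hθ : θ ∈ Set.Icc (π / 3) (2 * π / 3)) :
    vertexFunctional (printedWeights θ) tFiveEighths (ybCoeff θ) (boxMinus m n [h, (h.1 - 2, h.2 + 1)])
      (Face.side (h.1 + 1, h.2) .W) (farW (h.1 + 1, h.2)) ≠ 0 := by
  obtain ⟨hf, hh, hKN, hT, hcolN⟩ := thinTopBox_hyps (m := m) (n := n) (S := [h, (h.1 - 2, h.2 + 1)]) hW (by omega)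
    (by omega) hN (by simp) (by
      rw [List.mem_cons, List.mem_singleton, not_or]
      exact ⟨fun e => by have := (Prod.ext_iff.1 e).1; simp only at this; omega,
        fun e => by have := (Prod.ext_iff.1 e).1; simp only at this; omega⟩)
  have hr := rootedFace_hroot_boxMinus_of_mem hf (by simp)
  have hBW : ∀ c ∈ underBlockW (h.1 + 1, h.2), c ∈ boxMinus m n [h, (h.1 - 2, h.2 + 1)] :=
    block_hroot_subset_boxMinus_of_bounds (m := m) (n := n) (h := h) underBlockW42 1 5 0 3 1 3 (by decide)
      (by omega) (by omega) (by omega) (by omega) ⟨by omega, by omega⟩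
  have hBE : ∀ c ∈ underBlockE (h.1 + 1, h.2), c ∈ boxMinus m n [h, (h.1 - 2, h.2 + 1)] :=
    block_hroot_subset_boxMinus_of_bounds (m := m) (n := n) (h := h) underBlockE42 1 5 0 3 1 3 (by decide)
      (by omega) (by omega) (by omega) (by omega) ⟨by omega, by omega⟩
  intro e0
  rcases eq_or_lt_of_le hθ.2 with e2 | h2
  · have hneg := im_vertexFunctional_printed_neg_of_thinN_of_w1free (Dl := boxMinus m n [h, (h.1 - 2, h.2 + 1)])
      (θ := θ) ⟨by rw [e2]; linarith [Real.pi_pos], hθ.2⟩ hf hh hKN hT hcolN hr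
      fun θ' => exists_under_w1free_of_underBlockW hBW hr θ'
    rw [e0, Complex.zero_im] at hneg
    exact lt_irrefl _ hneg
  · have hneg := im_vertexFunctional_printed_neg_of_thinN_of_w2free (Dl := boxMinus m n [h, (h.1 - 2, h.2 + 1)])
      (θ := θ) ⟨hθ.1, h2⟩ hf hh hKN hT hcolN hr fun θ' => exists_under_w2free_of_underBlockE hBE hr θ'
    rw [e0, Complex.zero_im] at hneg
    exact lt_irrefl _ hneg

end ThinTopWalls

end Literature.Barriers.CriticalPhenomena.PlaquetteWalk
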